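import Literature.NumberTheory.LFunctions.Zhang2022.RepairLengthKnifeEdge
import Literature.NumberTheory.LFunctions.Zhang2022.RepairTentForm
import Literature.NumberTheory.LFunctions.Zhang2022.MainTermFormH1Kernel

/-!
# Zhang (2022), repair rung F-S1R, Q3-annex: the length knife edge is EXACTLY at `P` — general theorem

Y. Zhang, *Discrete mean estimates and the Landau–Siegel zero*, arXiv:2211.02515v1 [Zhang2022LandauSiegel] —
an unrefereed manuscript under adjudication; **nothing here asserts any of its claims, and nothing here is a
statement about Landau–Siegel zeros.** Repair rung (human ruling D-0077), lever L10 («lengths») of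
`repair/LEVERS.md`; companion of `RepairLengthKnifeEdge` (the point exhibit on the manuscript's own piece
`ϰ_{21/20, 5/2}`); statement and proof kit of the theory seat (`repair/theory/KNIFE-EDGES.md`).

**Objects.** `MformTop T` (formula I of Prop 7.1/Lemmas 8.2–8.4 with free upper limit `T`; `MformTop 1 = Mform`),
`topDiagForm T g g' := M_T(g,g) + conj M_T(g,g)`, and `OneSidedProfile T g g'` (continuous on `[0,T]`, right
derivative `g′` on `(0,T)`, `g(T) = 0` — the shape of the manuscript's coefficient profiles at logarithmic length `T`).
**Theorem (knife edge at `T = 1`, i.e. at length `P`).** `topDiagForm_re_nonneg_of_le_one`: for `T ≤ 1` and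
every kinked profile vanishing on `[T,1]`, `Re 𝔅_T(g) = 𝔅(g) ≥ 0` (`M_T = M` there; Gram identity of
`RepairFormulaIGram`; PSD theorem `MainTermFormH1.mainTermForm_nonneg_of_isH1`). `topForm_indefinite`: **for every
`θ > 1` there is a one-sided profile `g` on `[0,θ]` with `Re 𝔅_θ(g) = −1`.** Witness `g = s·g⋆ + φ_θ`: `g⋆ =
e^{−iπy} + e^{−2iπy}` on `[0,1]`, `0` beyond (a KERNEL mode of `𝔅`, `MainTermFormKernel.mainTermForm_afeSpan`,
`g⋆(1) = 0`); `φ_θ = (y−1)(θ−y)` on `[1,θ]`, `0` below; `Φ = ∫₁^θφ_θ = (θ−1)³/6`; `s = −(Re 𝔅_θ(φ_θ) + 1)/(48πΦ)`.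
Identities: `M_θ(g⋆,g⋆) = M(g⋆,g⋆)`, `2Re = 𝔅(g⋆) = 0`; `M_θ(φ,g⋆) = 0`; `M_θ(g⋆,φ) = πΦ·Σ_j W_jN_j[g⋆(1) − g⋆(0) +
iπb_j∫₀¹g⋆] = πΦ(3·0 + 6·2 + 3·4) = 24πΦ` — only the TAIL `π²N_j∫_y^θ` couples mass beyond `P` to `[0,1]`; so
`M_θ(g,g) = s²M(g⋆,g⋆) + 24πsΦ + M_θ(φ,φ)` (`MformTop_wit`) and `Re 𝔅_θ(g) = 48πsΦ + Re 𝔅_θ(φ) = −1`. Reading (theory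
seat): the Cauchy–Schwarz protection behind «not repairable in class» holds iff every length is `≤ P`; (7.2)'s cut
at `PT⁻²` removes exactly the coupling `24π`; a repair by LENGTH needs the off-diagonal main term (E*-len, open in
print). **Caveat:** `M_T`, `T > 1`, is formula I's calculus continued, not a proved main term. No new `Prop` facts.
-/

noncomputable section

open Complex Real ComplexConjugate Set MeasureTheory intervalIntegral

namespace Literature.NumberTheory.LFunctions.Zhang2022

namespace Repair

/-- A one-sided profile of logarithmic length `T`: continuous on `[0,T]`, a marked RIGHT derivative at every
interior point, vanishing at the end (`T = 1`: profiles on `n ≤ P`). [cite: Zhang2022LandauSiegel, Prop 7.1 p.44, (7.2)] -/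
structure OneSidedProfile (T : ℝ) (g g' : ℝ → ℂ) : Prop where
  cont : ContinuousOn g (Icc 0 T)
  hasDeriv : ∀ x ∈ Ioo (0:ℝ) T, HasDerivWithinAt g (g' x) (Ioi x) x
  top : g T = 0

/-- The continued one-sided diagonal form `𝔅_T(g) := M_T(g,g) + conj M_T(g,g)` (`= 𝔅(g)` for `T = 1`, `g(1) = 0`,
by the Gram identity). [cite: Zhang2022LandauSiegel, Prop 7.1 p.44, (7.2)] -/
def topDiagForm (T : ℝ) (g g' : ℝ → ℂ) : ℂ := MformTop T g g' g g' + conj (MformTop T g g' g g')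

/-- `Re 𝔅_T(g) = 2 Re M_T(g,g)`. [cite: Zhang2022LandauSiegel, Prop 7.1 p.44, (7.2)] -/
theorem topDiagForm_re (T : ℝ) (g g' : ℝ → ℂ) : (topDiagForm T g g').re = 2 * (MformTop T g g' g g').re := by
  simp only [topDiagForm, Complex.add_re, Complex.conj_re]; ring

/-- The point exhibit's functional is this form: `kappaDiagTop k ν = 𝔅_ν(ϰ_{ν,k})`. [cite: Zhang2022LandauSiegel, (2.23)–(2.25) p.9] -/
theorem kappaDiagTop_eq_topDiagForm (k ν : ℝ) : kappaDiagTop k ν = topDiagForm ν (kappaP ν k) (kappaP' ν k) := rfl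

section LeOne

variable {T : ℝ} {g g' h h' : ℝ → ℂ}

/-- For `T ≤ 1` and kinked profiles vanishing on `[T,1]`, `M_T(g,h) = M(g,h)`. [cite: Zhang2022LandauSiegel, Prop 7.1 p.44, (7.2)] -/
theorem MformTop_eq_Mform_of_vanish (hT0 : 0 ≤ T) (hT : T ≤ 1) (hg : KinkedProfile g g')
    (hh : KinkedProfile h h') (hg0 : ∀ y, T ≤ y → g y = 0) (hg'0 : ∀ y, T ≤ y → g' y = 0)
    (hh0 : ∀ y, T ≤ y → h y = 0) : MformTop T g g' h h' = Mform g g' h h' := by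
  have hhi : ∀ a b, a ∈ Icc (0:ℝ) 1 → b ∈ Icc (0:ℝ) 1 → IntervalIntegrable h volume a b := fun a b ha hb =>
    (hh.cont.mono (uIcc_subset_Icc ha hb)).intervalIntegrable
  have hT1 : T ∈ Icc (0:ℝ) 1 := ⟨hT0, hT⟩
  -- the tail: `∫_y^T h = ∫_y^1 h` for `y ∈ [0,T]`
  have tail : ∀ y, 0 ≤ y → y ≤ T → ∫ t in y..T, h t = ∫ t in y..1, h t := by
    intro y hy0 hyT
    have h0 : ∫ t in T..1, h t = 0 := by
      rw [← intervalIntegral.integral_zero]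
      exact intervalIntegral.integral_congr fun t ht => by rw [uIcc_of_le hT] at ht; exact hh0 t ht.1
    rw [← intervalIntegral.integral_add_adjacent_intervals (hhi y T ⟨hy0, hyT.trans hT⟩ hT1)
      (hhi T 1 hT1 ⟨zero_le_one, le_rfl⟩), h0, add_zero]
  have key : ∀ j : ℕ, ∫ y in (0:ℝ)..T, dipoleIntegrandTop T j g g' h h' y
      = ∫ y in (0:ℝ)..1, dipoleIntegrand j g g' h h' y := by
    intro j
    have hI := intervalIntegrable_dipoleIntegrand hg hh j
    have hI1 : IntervalIntegrable (dipoleIntegrand j g g' h h') volume 0 T :=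
      hI.mono_set (by rw [uIcc_of_le hT0, uIcc_of_le zero_le_one]; exact Icc_subset_Icc_right hT)
    have hI2 : IntervalIntegrable (dipoleIntegrand j g g' h h') volume T 1 :=
      hI.mono_set (by rw [uIcc_of_le hT, uIcc_of_le zero_le_one]; exact Icc_subset_Icc_left hT0)
    have e1 : ∫ y in (0:ℝ)..T, dipoleIntegrandTop T j g g' h h' y
        = ∫ y in (0:ℝ)..T, dipoleIntegrand j g g' h h' y := by
      refine intervalIntegral.integral_congr fun y hy => ?_
      rw [uIcc_of_le hT0] at hy
      unfold dipoleIntegrandTop dipoleIntegrand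
      rw [tail y hy.1 hy.2]
    have e2 : ∫ y in T..1, dipoleIntegrand j g g' h h' y = 0 := by
      rw [← intervalIntegral.integral_zero]
      refine intervalIntegral.integral_congr fun y hy => ?_
      rw [uIcc_of_le hT] at hy
      unfold dipoleIntegrand
      rw [hg0 y hy.1, hg'0 y hy.1]; ring
    rw [e1, ← intervalIntegral.integral_add_adjacent_intervals hI1 hI2, e2, add_zero]
  unfold MformTop Mform
  rw [key, key, key]

/-- **PSD up to length `P`**: for `0 < T ≤ 1` and every kinked profile `g` vanishing on `[T, 1]` (with its right
derivative), `Re 𝔅_T(g) = 𝔅(g) ≥ 0` (`mainTermForm_nonneg_of_isH1`). [cite: Zhang2022LandauSiegel, Prop 7.1 p.44, (7.2)] -/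
theorem topDiagForm_re_nonneg_of_le_one (hT0 : 0 < T) (hT : T ≤ 1) (hg : KinkedProfile g g')
    (hg0 : ∀ y, T ≤ y → g y = 0) (hg'0 : ∀ y, T ≤ y → g' y = 0) : 0 ≤ (topDiagForm T g g').re := by
  have h1 : g 1 = 0 := hg0 1 hT
  unfold topDiagForm
  rw [MformTop_eq_Mform_of_vanish hT0.le hT hg hg hg0 hg'0 hg0, ← mainTermFormPolar_eq_Mform hg hg h1 h1,
    mainTermFormPolar_self, Complex.ofReal_re]
  exact mainTermForm_nonneg_of_isH1 hg.isH1

end LeOne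

/-- the kernel mode `g⋆ = e^{−iπy} + e^{−2iπy}` (in the AFE span, `MainTermFormKernel`). [cite: Zhang2022LandauSiegel, Prop 7.1 p.44, (7.2)] -/
def gCore (y : ℝ) : ℂ := (1:ℂ) * afeDir 1 y + (1:ℂ) * afeDir 2 y + (0:ℂ) * afeDir 3 y

/-- its derivative. [cite: Zhang2022LandauSiegel, Prop 7.1 p.44, (7.2)] -/
def gCore' (y : ℝ) : ℂ := (1:ℂ) * afeDir' 1 y + (1:ℂ) * afeDir' 2 y + (0:ℂ) * afeDir' 3 y

/-- `g⋆` cut off at `1`: `g⋆(min(y,1))` (`= 0` beyond `1` as `g⋆(1) = 0`; continuous). [cite: Zhang2022LandauSiegel, Prop 7.1 p.44, (7.2)] -/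
def gStar (y : ℝ) : ℂ := gCore (min y 1)

/-- right derivative of `gStar`. [cite: Zhang2022LandauSiegel, Prop 7.1 p.44, (7.2)] -/
def gStar' (y : ℝ) : ℂ := if y < 1 then gCore' y else 0

/-- the bump beyond `P`: `φ_θ(y) = (y−1)(θ−y)` for `y ≥ 1`, `0` below (continuous, real). [cite: Zhang2022LandauSiegel, Prop 7.1 p.44, (7.2)] -/
def phiT (θ : ℝ) (y : ℝ) : ℂ := (((max y 1 - 1) * (θ - max y 1) : ℝ) : ℂ)

/-- right derivative of `phiT`. [cite: Zhang2022LandauSiegel, Prop 7.1 p.44, (7.2)] -/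
def phiT' (θ : ℝ) (y : ℝ) : ℂ := if 1 ≤ y then (((θ + 1 - 2 * y) : ℝ) : ℂ) else 0

/-- `Φ(θ) = ∫₁^θ φ_θ = (θ−1)³/6`. [cite: Zhang2022LandauSiegel, Prop 7.1 p.44, (7.2)] -/
def phiInt (θ : ℝ) : ℝ := (θ - 1) ^ 3 / 6

/-- the witness `g = s·g⋆ + φ_θ`. [cite: Zhang2022LandauSiegel, Prop 7.1 p.44, (7.2)] -/
def wit (θ s : ℝ) (y : ℝ) : ℂ := (s : ℂ) * gStar y + phiT θ y

/-- right derivative of the witness. [cite: Zhang2022LandauSiegel, Prop 7.1 p.44, (7.2)] -/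
def wit' (θ s : ℝ) (y : ℝ) : ℂ := (s : ℂ) * gStar' y + phiT' θ y

section Witness
variable {θ : ℝ} {y : ℝ}

/-- `g⋆(1) = 0`. [cite: Zhang2022LandauSiegel, Prop 7.1 p.44, (7.2)] -/
theorem gCore_one : gCore 1 = 0 := by rw [gCore, afeDir_one, afeDir_one, afeDir_one]; norm_num

/-- `g⋆(0) = 2`. [cite: Zhang2022LandauSiegel, Prop 7.1 p.44, (7.2)] -/
theorem gCore_zero : gCore 0 = 2 := by rw [gCore, afeDir_zero, afeDir_zero, afeDir_zero]; norm_num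

/-- `g⋆` is continuous. [cite: Zhang2022LandauSiegel, Prop 7.1 p.44, (7.2)] -/
theorem continuous_gCore : Continuous gCore := by
  unfold gCore
  exact ((continuous_const.mul (continuous_afeDir 1)).add (continuous_const.mul (continuous_afeDir 2))).add
    (continuous_const.mul (continuous_afeDir 3))

/-- `g⋆ ∈ C¹[0,1]` (a member of the AFE span). [cite: Zhang2022LandauSiegel, Prop 7.1 p.44, (7.2)] -/
theorem isC1_gCore : IsC1OnUnitInterval gCore gCore' := isC1_afeSpan 1 1 0

/-- `g⋆` is a kinked profile on `[0,1]`. [cite: Zhang2022LandauSiegel, Prop 7.1 p.44, (7.2)] -/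
theorem kinkedProfile_gCore : KinkedProfile gCore gCore' where
  cont := isC1_gCore.cont
  hasDeriv := fun x hx => (isC1_gCore.hasDeriv x hx).hasDerivWithinAt
  memLp := isC1_gCore.isH1.memLp

/-- **`𝔅(g⋆) = 0`**: `g⋆` is a kernel mode of the main-term form. [cite: Zhang2022LandauSiegel, Prop 7.1 p.44, (7.2)] -/
theorem mainTermForm_gCore : mainTermForm gCore gCore' = 0 := mainTermForm_afeSpan 1 1 0

/-- `∫₀¹ g⋆′ = −2`. [cite: Zhang2022LandauSiegel, Prop 7.1 p.44, (7.2)] -/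
theorem integral_gCore' : ∫ t in (0:ℝ)..1, gCore' t = -2 := by
  rw [intervalIntegral.integral_eq_sub_of_hasDerivAt_of_le zero_le_one isC1_gCore.cont isC1_gCore.hasDeriv
    (isC1_gCore.cont'.intervalIntegrable_of_Icc zero_le_one), gCore_one, gCore_zero]
  norm_num

/-- `∫₀¹ g⋆ = 2/(πi)` (`∫₀¹e^{−iπy} = −2i/π`, `∫₀¹e^{−2iπy} = 0`). [cite: Zhang2022LandauSiegel, Prop 7.1 p.44, (7.2)] -/
theorem integral_gCore : ∫ t in (0:ℝ)..1, gCore t = 2 / ((π : ℂ) * I) := by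
  have e : ∫ t in (0:ℝ)..1, gCore t = (∫ t in (0:ℝ)..1, afeDir 1 t) + ∫ t in (0:ℝ)..1, afeDir 2 t := by
    rw [← intervalIntegral.integral_add ((continuous_afeDir 1).intervalIntegrable (μ := volume) 0 1)
      ((continuous_afeDir 2).intervalIntegrable (μ := volume) 0 1)]
    exact intervalIntegral.integral_congr fun t _ => by simp [gCore]
  have hπ : (π : ℂ) ≠ 0 := by exact_mod_cast Real.pi_ne_zero
  have hI : (I : ℂ) ≠ 0 := Complex.I_ne_zero
  rw [e, primitive_afeDir one_ne_zero, primitive_afeDir two_ne_zero, afeDir_one, afeDir_one]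
  unfold afeFreq; push_cast; field_simp; ring

/-- `gStar = g⋆` on `(-∞, 1]`. [cite: Zhang2022LandauSiegel, Prop 7.1 p.44, (7.2)] -/
theorem gStar_of_le (hy : y ≤ 1) : gStar y = gCore y := by rw [gStar, min_eq_left hy]

/-- `gStar = 0` on `[1, ∞)`. [cite: Zhang2022LandauSiegel, Prop 7.1 p.44, (7.2)] -/
theorem gStar_of_ge (hy : 1 ≤ y) : gStar y = 0 := by rw [gStar, min_eq_right hy, gCore_one]

/-- `gStar′ = g⋆′` on `(-∞, 1)`. [cite: Zhang2022LandauSiegel, Prop 7.1 p.44, (7.2)] -/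
theorem gStar'_of_lt (hy : y < 1) : gStar' y = gCore' y := by simp [gStar', hy]

/-- `gStar′ = 0` on `[1, ∞)`. [cite: Zhang2022LandauSiegel, Prop 7.1 p.44, (7.2)] -/
theorem gStar'_of_ge (hy : 1 ≤ y) : gStar' y = 0 := by simp [gStar', not_lt.2 hy]

/-- `gStar` is continuous. [cite: Zhang2022LandauSiegel, Prop 7.1 p.44, (7.2)] -/
theorem continuous_gStar : Continuous gStar := continuous_gCore.comp (continuous_id.min continuous_const)

/-- `φ_θ = 0` on `(-∞, 1]`. [cite: Zhang2022LandauSiegel, Prop 7.1 p.44, (7.2)] -/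
theorem phiT_of_le (hy : y ≤ 1) : phiT θ y = 0 := by simp [phiT, max_eq_right hy]

/-- `φ_θ = (y−1)(θ−y)` on `[1, ∞)`. [cite: Zhang2022LandauSiegel, Prop 7.1 p.44, (7.2)] -/
theorem phiT_of_ge (hy : 1 ≤ y) : phiT θ y = (((y - 1) * (θ - y) : ℝ) : ℂ) := by rw [phiT, max_eq_left hy]

/-- `φ_θ′ = 0` on `(-∞, 1)`. [cite: Zhang2022LandauSiegel, Prop 7.1 p.44, (7.2)] -/
theorem phiT'_of_lt (hy : y < 1) : phiT' θ y = 0 := by simp [phiT', not_le.2 hy]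

/-- `φ_θ′ = θ + 1 − 2y` on `[1, ∞)`. [cite: Zhang2022LandauSiegel, Prop 7.1 p.44, (7.2)] -/
theorem phiT'_of_ge (hy : 1 ≤ y) : phiT' θ y = (((θ + 1 - 2 * y) : ℝ) : ℂ) := by simp [phiT', hy]

/-- `φ_θ` is continuous. [cite: Zhang2022LandauSiegel, Prop 7.1 p.44, (7.2)] -/
theorem continuous_phiT (θ : ℝ) : Continuous (phiT θ) := by unfold phiT; fun_prop

/-- `∫₁^θ φ_θ = Φ(θ)` (`θ ≥ 1`). [cite: Zhang2022LandauSiegel, Prop 7.1 p.44, (7.2)] -/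
theorem integral_phiT (hθ : 1 ≤ θ) : ∫ t in (1:ℝ)..θ, phiT θ t = ((phiInt θ : ℝ) : ℂ) := by
  have e : ∫ t in (1:ℝ)..θ, phiT θ t = ∫ t in (1:ℝ)..θ, (((t - 1) * (θ - t) : ℝ) : ℂ) := by
    refine intervalIntegral.integral_congr fun t ht => ?_
    rw [uIcc_of_le hθ] at ht
    exact phiT_of_ge ht.1
  have hF : ∀ t ∈ uIcc (1:ℝ) θ, HasDerivAt (fun t : ℝ => (θ + 1) * (t * t) / 2 - θ * t - t * t * t / 3)
      ((t - 1) * (θ - t)) t := by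
    intro t _
    have h2 : HasDerivAt (fun y : ℝ => y * y) (1 * t + t * 1) t := (hasDerivAt_id' t).mul (hasDerivAt_id' t)
    have h3 : HasDerivAt (fun y : ℝ => y * y * y) ((1 * t + t * 1) * t + t * t * 1) t :=
      h2.mul (hasDerivAt_id' t)
    have h := (((h2.const_mul (θ + 1)).div_const 2).sub ((hasDerivAt_id' t).const_mul θ)).sub
      (h3.div_const 3)
    refine h.congr_deriv ?_
    ring
  rw [e, intervalIntegral.integral_ofReal, intervalIntegral.integral_eq_sub_of_hasDerivAt hF
    ((Continuous.intervalIntegrable (by fun_prop) (μ := volume) _ _))]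
  unfold phiInt
  push_cast
  ring

/-- tail of the witness from `y ≤ 1`: `∫_y^θ g = s∫_y^1 g⋆ + Φ` (`g⋆ ⊕ 0` beyond `1`, `φ_θ = 0` below `1`).
[cite: Zhang2022LandauSiegel, Prop 7.1 p.44, (7.2)] -/
theorem tail_wit (hθ : 1 ≤ θ) (s : ℝ) (hy : y ≤ 1) :
    ∫ t in y..θ, wit θ s t = (s : ℂ) * (∫ t in y..1, gCore t) + ((phiInt θ : ℝ) : ℂ) := by
  have hg := fun a b => continuous_gStar.intervalIntegrable (μ := volume) a b
  have hp := fun a b => (continuous_phiT θ).intervalIntegrable (μ := volume) a b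
  have g0 : ∫ t in (1:ℝ)..θ, gStar t = 0 := by
    rw [← intervalIntegral.integral_zero]
    exact intervalIntegral.integral_congr fun t ht => by rw [uIcc_of_le hθ] at ht; exact gStar_of_ge ht.1
  have g1 : ∫ t in y..1, gStar t = ∫ t in y..1, gCore t :=
    intervalIntegral.integral_congr fun t ht => by rw [uIcc_of_le hy] at ht; exact gStar_of_le ht.2
  have p0 : ∫ t in y..1, phiT θ t = 0 := by
    rw [← intervalIntegral.integral_zero]
    exact intervalIntegral.integral_congr fun t ht => by rw [uIcc_of_le hy] at ht; exact phiT_of_le ht.2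
  unfold wit
  rw [intervalIntegral.integral_add ((hg y θ).const_mul _) (hp y θ), intervalIntegral.integral_const_mul,
    ← intervalIntegral.integral_add_adjacent_intervals (hg y 1) (hg 1 θ), g0, add_zero, g1,
    ← intervalIntegral.integral_add_adjacent_intervals (hp y 1) (hp 1 θ), p0, zero_add, integral_phiT hθ]

/-- the dipole integrand of the witness BELOW `P` (`0 ≤ y < 1`): `s²·D_j(g⋆,g⋆) + sπ²N_jΦ·(g⋆′ + iπj g⋆)` —
the second term is the tail coupling of the bump to the kernel mode. [cite: Zhang2022LandauSiegel, Prop 7.1 p.44, (7.2)] -/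
theorem dipoleIntegrandTop_wit_of_lt (hθ : 1 ≤ θ) (s : ℝ) (j : ℕ) (hy : y < 1) :
    dipoleIntegrandTop θ j (wit θ s) (wit' θ s) (wit θ s) (wit' θ s) y
      = (s : ℂ) ^ 2 * dipoleIntegrand j gCore gCore' gCore gCore' y
        + (s : ℂ) * (π : ℂ) ^ 2 * ((bN j : ℝ) : ℂ) * ((phiInt θ : ℝ) : ℂ)
          * (gCore' y + I * π * (j : ℂ) * gCore y) := by
  unfold dipoleIntegrandTop dipoleIntegrand
  rw [tail_wit hθ s hy.le]
  simp only [wit, wit', gStar_of_le hy.le, gStar'_of_lt hy, phiT_of_le hy.le, phiT'_of_lt hy, add_zero,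
    map_add, map_mul, map_pow, Complex.conj_ofReal, Complex.conj_I]
  ring

/-- the dipole integrand of the witness BEYOND `P` (`1 ≤ y ≤ θ`) is that of the bump alone.
[cite: Zhang2022LandauSiegel, Prop 7.1 p.44, (7.2)] -/
theorem dipoleIntegrandTop_wit_of_ge (s : ℝ) (j : ℕ) (hy : 1 ≤ y) (hyθ : y ≤ θ) :
    dipoleIntegrandTop θ j (wit θ s) (wit' θ s) (wit θ s) (wit' θ s) y
      = dipoleIntegrandTop θ j (phiT θ) (phiT' θ) (phiT θ) (phiT' θ) y := by
  have ht : ∫ t in y..θ, wit θ s t = ∫ t in y..θ, phiT θ t := intervalIntegral.integral_congr fun t ht => by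
    rw [uIcc_of_le hyθ] at ht; simp [wit, gStar_of_ge (hy.trans ht.1)]
  unfold dipoleIntegrandTop
  rw [ht]; simp [wit, wit', gStar_of_ge hy, gStar'_of_ge hy]

/-- the bump's dipole integrand is integrable on `[1, θ]` (continuous there). [cite: Zhang2022LandauSiegel, Prop 7.1 p.44, (7.2)] -/
theorem intervalIntegrable_dipoleIntegrandTop_phiT (hθ : 1 ≤ θ) (j : ℕ) :
    IntervalIntegrable (dipoleIntegrandTop θ j (phiT θ) (phiT' θ) (phiT θ) (phiT' θ)) volume 1 θ := by
  have hc := continuous_phiT θ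
  have htail : Continuous fun y => ∫ t in y..θ, phiT θ t := by
    have h := intervalIntegral.continuous_primitive (fun a b => hc.intervalIntegrable (μ := volume) a b) θ
    have e : (fun y => ∫ t in y..θ, phiT θ t) = fun y => -∫ t in θ..y, phiT θ t := by
      funext y; rw [intervalIntegral.integral_symm]
    rw [e]; exact h.neg
  have hF : Continuous fun y => ((((θ + 1 - 2 * y) : ℝ) : ℂ) + I * π * (j : ℂ) * phiT θ y)
      * conj ((((θ + 1 - 2 * y) : ℝ) : ℂ) + I * π * ((bS j : ℝ) : ℂ) * phiT θ y
        + (π : ℂ) ^ 2 * ((bN j : ℝ) : ℂ) * ∫ t in y..θ, phiT θ t) := by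
    have hl : Continuous fun y => (((θ + 1 - 2 * y) : ℝ) : ℂ) := by fun_prop
    refine (hl.add (continuous_const.mul hc)).mul ?_
    exact Complex.continuous_conj.comp ((hl.add (continuous_const.mul hc)).add (continuous_const.mul htail))
  refine (hF.intervalIntegrable (μ := volume) 1 θ).congr_uIoo fun y hy => ?_
  rw [uIoo_of_le hθ] at hy
  unfold dipoleIntegrandTop
  rw [phiT'_of_ge hy.1.le]

/-- **The expansion**: `M_θ(g,g) = s²·M(g⋆,g⋆) + 24πsΦ + M_θ(φ_θ,φ_θ)` for the witness `g = s·g⋆ + φ_θ`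
(`θ ≥ 1`): the coupling constant `Σ_j W_jN_j(2j − 2) = 3·0 + 6·2 + 3·4 = 24`. [cite: Zhang2022LandauSiegel, Prop 7.1 p.44, (7.2)] -/
theorem MformTop_wit (hθ : 1 ≤ θ) (s : ℝ) :
    MformTop θ (wit θ s) (wit' θ s) (wit θ s) (wit' θ s)
      = (s : ℂ) ^ 2 * Mform gCore gCore' gCore gCore' + 24 * π * (s : ℂ) * ((phiInt θ : ℝ) : ℂ)
        + MformTop θ (phiT θ) (phiT' θ) (phiT θ) (phiT' θ) := by
  have hπ : (π : ℂ) ≠ 0 := by exact_mod_cast Real.pi_ne_zero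
  have key : ∀ j : ℕ, ∫ y in (0:ℝ)..θ, dipoleIntegrandTop θ j (wit θ s) (wit' θ s) (wit θ s) (wit' θ s) y
      = (s : ℂ) ^ 2 * (∫ y in (0:ℝ)..1, dipoleIntegrand j gCore gCore' gCore gCore' y)
        + (s : ℂ) * (π : ℂ) ^ 2 * ((bN j : ℝ) : ℂ) * ((phiInt θ : ℝ) : ℂ) * (2 * (j : ℂ) - 2)
        + ∫ y in (0:ℝ)..θ, dipoleIntegrandTop θ j (phiT θ) (phiT' θ) (phiT θ) (phiT' θ) y := by
    intro j
    set D := dipoleIntegrandTop θ j (wit θ s) (wit' θ s) (wit θ s) (wit' θ s)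
    set Dφ := dipoleIntegrandTop θ j (phiT θ) (phiT' θ) (phiT θ) (phiT' θ)
    have iG' : IntervalIntegrable gCore' volume 0 1 := isC1_gCore.cont'.intervalIntegrable_of_Icc zero_le_one
    have iG : IntervalIntegrable (fun y => I * π * (j : ℂ) * gCore y) volume 0 1 :=
      (continuous_gCore.intervalIntegrable _ _).const_mul _
    have i1a : IntervalIntegrable (fun y => (s : ℂ) ^ 2 * dipoleIntegrand j gCore gCore' gCore gCore' y)
      volume 0 1 := (intervalIntegrable_dipoleIntegrand kinkedProfile_gCore kinkedProfile_gCore j).const_mul _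
    have i1b : IntervalIntegrable (fun y => (s : ℂ) * (π : ℂ) ^ 2 * ((bN j : ℝ) : ℂ) * ((phiInt θ : ℝ) : ℂ)
        * (gCore' y + I * π * (j : ℂ) * gCore y)) volume 0 1 := (iG'.add iG).const_mul _
    have hEq1 : EqOn D (fun y => (s : ℂ) ^ 2 * dipoleIntegrand j gCore gCore' gCore gCore' y
        + (s : ℂ) * (π : ℂ) ^ 2 * ((bN j : ℝ) : ℂ) * ((phiInt θ : ℝ) : ℂ)
          * (gCore' y + I * π * (j : ℂ) * gCore y)) (uIoo 0 1) := fun y hy => by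
      rw [uIoo_of_le zero_le_one] at hy; exact dipoleIntegrandTop_wit_of_lt hθ s j hy.2
    have hEq2 : EqOn D Dφ (uIoo 1 θ) := fun y hy => by
      rw [uIoo_of_le hθ] at hy; exact dipoleIntegrandTop_wit_of_ge s j hy.1.le hy.2.le
    have hEq3 : EqOn Dφ (fun _ => (0:ℂ)) (uIoo 0 1) := fun y hy => by
      rw [uIoo_of_le zero_le_one] at hy
      change dipoleIntegrandTop θ j (phiT θ) (phiT' θ) (phiT θ) (phiT' θ) y = 0
      unfold dipoleIntegrandTop; rw [phiT_of_le hy.2.le, phiT'_of_lt hy.2]; ring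
    have iφ2 : IntervalIntegrable Dφ volume 1 θ := intervalIntegrable_dipoleIntegrandTop_phiT hθ j
    have iφ1 : IntervalIntegrable Dφ volume 0 1 := (intervalIntegrable_const (c := (0:ℂ))).congr_uIoo hEq3.symm
    have i1 : IntervalIntegrable D volume 0 1 := (i1a.add i1b).congr_uIoo hEq1.symm
    have i2 : IntervalIntegrable D volume 1 θ := iφ2.congr_uIoo hEq2.symm
    have hI : (I : ℂ) ≠ 0 := Complex.I_ne_zero
    have hbr : (-2 : ℂ) + I * π * (j : ℂ) * (2 / ((π : ℂ) * I)) = 2 * (j : ℂ) - 2 := by field_simp; ring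
    rw [← intervalIntegral.integral_add_adjacent_intervals i1 i2, intervalIntegral.integral_congr_uIoo hEq1,
      intervalIntegral.integral_congr_uIoo hEq2,
      ← intervalIntegral.integral_add_adjacent_intervals iφ1 iφ2, intervalIntegral.integral_congr_uIoo hEq3,
      intervalIntegral.integral_zero, zero_add, intervalIntegral.integral_add i1a i1b,
      intervalIntegral.integral_const_mul, intervalIntegral.integral_const_mul,
      intervalIntegral.integral_add iG' iG, intervalIntegral.integral_const_mul, integral_gCore', integral_gCore,
      hbr]
  unfold MformTop Mform
  rw [key, key, key, bN_one, bN_two, bN_three]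
  push_cast; field_simp; ring

/-- the witness is a one-sided profile on `[0, θ]` (`θ ≥ 1`). [cite: Zhang2022LandauSiegel, Prop 7.1 p.44, (7.2)] -/
theorem oneSidedProfile_wit (hθ : 1 ≤ θ) (s : ℝ) : OneSidedProfile θ (wit θ s) (wit' θ s) where
  cont := ((continuous_const.mul continuous_gStar).add (continuous_phiT θ)).continuousOn
  top := by simp [wit, gStar_of_ge hθ, phiT_of_ge hθ]
  hasDeriv := by
    intro x hx
    by_cases hx1 : x < 1
    · have hG : HasDerivAt gStar (gCore' x) x := (isC1_gCore.hasDeriv x ⟨hx.1, hx1⟩).congr_of_eventuallyEq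
        (by filter_upwards [Iio_mem_nhds hx1] with y hy using gStar_of_le hy.le)
      have hP : HasDerivAt (phiT θ) 0 x := (hasDerivAt_const x (0:ℂ)).congr_of_eventuallyEq
        (by filter_upwards [Iio_mem_nhds hx1] with y hy using phiT_of_le hy.le)
      have h := (hG.const_mul (s : ℂ)).add hP
      rw [wit', gStar'_of_lt hx1, phiT'_of_lt hx1]
      exact h.hasDerivWithinAt.congr (fun _ _ => rfl) rfl
    · have hx1' : 1 ≤ x := not_lt.1 hx1
      have hG : HasDerivWithinAt gStar 0 (Ioi x) x := (hasDerivWithinAt_const x (Ioi x) (0:ℂ)).congr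
        (fun y hy => gStar_of_ge (hx1'.trans (le_of_lt hy))) (gStar_of_ge hx1')
      have hPoly : HasDerivAt (fun y : ℝ => ((((y - 1) * (θ - y)) : ℝ) : ℂ)) ((((θ + 1 - 2 * x)) : ℝ) : ℂ) x := by
        refine (((hasDerivAt_id x).sub_const 1).mul ((hasDerivAt_id x).const_sub θ)).ofReal_comp.congr_deriv ?_
        simp; ring
      have hP : HasDerivWithinAt (phiT θ) ((((θ + 1 - 2 * x)) : ℝ) : ℂ) (Ioi x) x :=
        hPoly.hasDerivWithinAt.congr (fun y hy => phiT_of_ge (hx1'.trans (le_of_lt hy))) (phiT_of_ge hx1')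
      have h := (hG.const_mul (s : ℂ)).add hP
      rw [wit', gStar'_of_ge hx1', phiT'_of_ge hx1']
      exact h.congr (fun _ _ => rfl) rfl

end Witness

/-- **LENGTH KNIFE EDGE AT EXACTLY `P` (indefinite side).** For every `θ > 1` there is a one-sided profile
`g` on `[0, θ]` (continuous, right-differentiable, `g(θ) = 0`) with NEGATIVE continued diagonal formula-I form,
`Re 𝔅_θ(g) = −1`; witness `g = s·g⋆ + φ_θ` as in the module docstring. With `topDiagForm_re_nonneg_of_le_one`:
the diagonal form is PSD iff the length is `≤ P` — (7.2) sits exactly at the edge. [cite: Zhang2022LandauSiegel, Prop 7.1 p.44, (7.2)] -/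
theorem topForm_indefinite {θ : ℝ} (hθ : 1 < θ) :
    ∃ g g' : ℝ → ℂ, OneSidedProfile θ g g' ∧ (topDiagForm θ g g').re = -1 := by
  set Φ : ℝ := phiInt θ with hΦ
  have hΦpos : 0 < Φ := by rw [hΦ]; unfold phiInt; nlinarith [pow_pos (sub_pos.2 hθ) 3]
  set q : ℝ := (topDiagForm θ (phiT θ) (phiT' θ)).re with hq
  set s : ℝ := -(q + 1) / (48 * π * Φ) with hs
  refine ⟨wit θ s, wit' θ s, oneSidedProfile_wit hθ.le s, ?_⟩
  have h0 : (Mform gCore gCore' gCore gCore' + conj (Mform gCore gCore' gCore gCore')).re = 0 := by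
    rw [← mainTermFormPolar_eq_Mform kinkedProfile_gCore kinkedProfile_gCore gCore_one gCore_one,
      mainTermFormPolar_self, Complex.ofReal_re, mainTermForm_gCore]
  have e1 : ((s : ℂ) ^ 2 * Mform gCore gCore' gCore gCore').re = 0 := by
    simp only [Complex.add_re, Complex.conj_re] at h0
    rw [← Complex.ofReal_pow, Complex.re_ofReal_mul]; nlinarith
  have e2 : (24 * (π : ℂ) * (s : ℂ) * ((Φ : ℝ) : ℂ)).re = 24 * π * s * Φ := by
    rw [show (24 * (π : ℂ) * (s : ℂ) * ((Φ : ℝ) : ℂ)) = ((24 * π * s * Φ : ℝ) : ℂ) by push_cast; ring, Complex.ofReal_re]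
  have hq' : (MformTop θ (phiT θ) (phiT' θ) (phiT θ) (phiT' θ)).re = q / 2 := by rw [hq, topDiagForm_re]; ring
  rw [topDiagForm_re, MformTop_wit hθ.le s, Complex.add_re, Complex.add_re, e1, e2, hq', hs]
  have hπ : π ≠ 0 := Real.pi_ne_zero
  field_simp
  ring

end Repair

end Literature.NumberTheory.LFunctions.Zhang2022
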